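import Literature.NumberTheory.LFunctions.DirichletPolynomialActivatedMVT
import Literature.NumberTheory.LFunctions.LevinsonCoincidenceSums
import HarnessLib

/-!
# The mean square of `ψ(s) · Σ_{n ≤ √(t/2π)} α_n n^{−s}` on `σ = a`: diagonal plus off-diagonal error

Topic `Literature/NumberTheory/LFunctions`. Everything in this file is PROVED (no definitions, no
named facts).

The pieces `I₁₁ = ∫ |ψ g₁(a+it)|² dt` and `I₂₂ = ∫ |χ|² |ψ g₂(a+it)|² dt` of Levinson's mollified
mean square (N. Levinson, Adv. Math. 13 (1974), (2.22)–(2.23), §4), and their analogues for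
Conrey's `V` (`ConreyVApproxFunctionalEq.lean`: `V = Σ_{n ≤ N(t)} 𝜙(log n/L) n^{−s} + χ Σ …`), are
mean squares of a product `ψ(a+it) · A_t(a+it)` of the mollifier
`ψ(s) = Σ_{k ≤ K} β_k k^{−s}` and an approximate-functional-equation sum
`A_t(s) = Σ_{n ≤ ⌊√(t/2π)⌋} α_n n^{−s}` of `t`-dependent length (for `I₂₂` after `|ψ g₂| = |ψ ḡ₂|`,
which turns `n^{s−1}` into `n^{a−1−it}` and keeps the frequencies `kn` integral). Here we carry out
the term-by-term integration with the pair-dependent ranges (Titchmarsh §7.4; Levinson §4 with his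
Lemmas 3.2, 3.6): the product is the "activated" Dirichlet polynomial over pairs `i = (k, n)`,
coefficient `x_i = β_k α_n (kn)^{−a}`, frequency `μ_i = kn`, activation time `τ_i = 2πn²`
(`LevinsonMS.mul_sum_eq_activated`), so that the tree's
`Literature.NumberTheory.LFunctions.DirichletMVT.norm_weighted_meanSquare_activated_sub_le_crude`
applies, and the diagonal multiplicities are controlled by
`Literature.NumberTheory.LFunctions.LevinsonSums.sum_coincidence_div_le`:

* `LevinsonMS.norm_weighted_meanSquare_mul_sub_diag_le` — for `a ≤ ½`, `0 ≤ T ≤ T'`, `|β_k| ≤ B`,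
  `|α_n| ≤ C`, a `C¹` weight `w` (`|w| ≤ W₀`, `∫|w'| ≤ W₁`), `N' = ⌊√(T'/2π)⌋`, `M = KN'`:
  `‖∫_T^{T'} w |ψ A_t(a+it)|² dt − Σ_{kn = k'n'} x_{k,n} x̄_{k',n'} ∫_T^{T'} [2πn² ≤ t][2πn'² ≤ t] w(t) dt‖`
  `  ≤ (2W₀ + W₁) · 2M(1 + log M) · B²C² M^{1−2a} (1 + log N')(1 + log K)³`.

With Levinson's `K = y = T^{1/2}(log T)^{−20}`, `N' ≍ T^{1/2}`, `a = ½ − R/log T` (`M^{1−2a} ≤ e^{2R}`)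
the right side is `O(W T (log T)^{−15})`, i.e. `o(T)`: only the diagonal, an explicit arithmetic
sum, contributes to the constant of the mean square.

## References

* N. Levinson, *More than one third of zeros of Riemann's zeta-function are on `σ = 1/2`*,
  Adv. Math. 13 (1974), 383–436, §2 (2.19)–(2.27), §3 Lemmas 3.2, 3.6, §4. [Levinson1974]
* E. C. Titchmarsh, *The Theory of the Riemann Zeta-Function*, 2nd ed. (1986), §7.4. [Titchmarsh1986]
-/

noncomputable section

open Finset Real MeasureTheory Complex Set intervalIntegral
open scoped ComplexConjugate

namespace Literature.NumberTheory.LFunctions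

namespace LevinsonMS

/-! ### The product `ψ · A_t` as an activated Dirichlet polynomial over pairs -/

/-- `n ≤ ⌊√(t/2π)⌋ ↔ 2πn² ≤ t` for `n ≥ 1`, `t ≥ 0`. [folklore] -/
theorem le_natFloor_sqrt_iff {n : ℕ} (hn : 1 ≤ n) {t : ℝ} (ht : 0 ≤ t) :
    n ≤ ⌊Real.sqrt (t / (2 * π))⌋₊ ↔ 2 * π * (n : ℝ) ^ 2 ≤ t := by
  have hπ := Real.pi_pos
  rw [Nat.le_floor_iff' (by omega), Real.le_sqrt (by positivity) (by positivity),
    le_div_iff₀ (by positivity)]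
  constructor <;> intro h <;> nlinarith

/-- The t-dependent sum as an activated sum over `[1, N']` for any `N' ≥ ⌊√(t/2π)⌋`. [folklore] -/
theorem sum_Icc_natFloor_eq_sum_ite {N' : ℕ} {t : ℝ} (ht : 0 ≤ t) (hN' : ⌊Real.sqrt (t / (2 * π))⌋₊ ≤ N')
    (f : ℕ → ℂ) :
    ∑ n ∈ Finset.Icc 1 ⌊Real.sqrt (t / (2 * π))⌋₊, f n =
      ∑ n ∈ Finset.Icc 1 N', (if 2 * π * (n : ℝ) ^ 2 ≤ t then f n else 0) := by
  rw [← Finset.sum_filter]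
  congr 1
  ext n
  simp only [Finset.mem_Icc, Finset.mem_filter]
  constructor
  · rintro ⟨h1, h2⟩
    exact ⟨⟨h1, h2.trans hN'⟩, (le_natFloor_sqrt_iff h1 ht).1 h2⟩
  · rintro ⟨⟨h1, _⟩, h3⟩
    exact ⟨h1, (le_natFloor_sqrt_iff h1 ht).2 h3⟩

/-- `(kn)^{−(a+it)} = (kn)^{−a} · (kn)^{−it}` with the real power as a real number. [folklore] -/
theorem natCast_cpow_neg_add_eq {m : ℕ} (hm : 1 ≤ m) (a t : ℝ) :
    (m : ℂ) ^ (-((a : ℂ) + t * I)) = (((m : ℝ) ^ (-a) : ℝ) : ℂ) * (m : ℂ) ^ (-((t : ℂ) * I)) := by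
  have hm0 : (m : ℂ) ≠ 0 := by exact_mod_cast (show m ≠ 0 by omega)
  rw [neg_add, Complex.cpow_add _ _ hm0, Complex.ofReal_cpow (Nat.cast_nonneg m)]
  push_cast
  ring_nf

/-- **The product as an activated Dirichlet polynomial.** For `t ≥ 0`, `N' ≥ ⌊√(t/2π)⌋`:
`(Σ_{k ≤ K} β_k k^{−(a+it)}) (Σ_{n ≤ ⌊√(t/2π)⌋} α_n n^{−(a+it)})`
`  = Σ_{(k,n) ∈ [1,K]×[1,N'], 2πn² ≤ t} (β_k α_n (kn)^{−a}) (kn)^{−it}`. [folklore] -/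
theorem mul_sum_eq_activated (β α : ℕ → ℂ) (K : ℕ) {N' : ℕ} (a : ℝ) {t : ℝ} (ht : 0 ≤ t)
    (hN' : ⌊Real.sqrt (t / (2 * π))⌋₊ ≤ N') :
    (∑ k ∈ Finset.Icc 1 K, β k * (k : ℂ) ^ (-((a : ℂ) + t * I))) *
        (∑ n ∈ Finset.Icc 1 ⌊Real.sqrt (t / (2 * π))⌋₊, α n * (n : ℂ) ^ (-((a : ℂ) + t * I))) =
      ∑ i ∈ Finset.Icc 1 K ×ˢ Finset.Icc 1 N',
        (if 2 * π * ((i.2 : ℕ) : ℝ) ^ 2 ≤ t then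
          (β i.1 * α i.2 * ((((i.1 * i.2 : ℕ) : ℝ) ^ (-a) : ℝ) : ℂ)) *
            ((i.1 * i.2 : ℕ) : ℂ) ^ (-((t : ℂ) * I)) else 0) := by
  rw [sum_Icc_natFloor_eq_sum_ite ht hN', Finset.sum_mul_sum, Finset.sum_product]
  refine Finset.sum_congr rfl fun k hk => Finset.sum_congr rfl fun n hn => ?_
  have hk1 : 1 ≤ k := (Finset.mem_Icc.1 hk).1
  have hn1 : 1 ≤ n := (Finset.mem_Icc.1 hn).1
  split_ifs with h
  · dsimp only
    rw [natCast_cpow_neg_add_eq hk1, natCast_cpow_neg_add_eq hn1]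
    have e3 : ((k * n : ℕ) : ℂ) ^ (-((t : ℂ) * I)) =
        (k : ℂ) ^ (-((t : ℂ) * I)) * (n : ℂ) ^ (-((t : ℂ) * I)) := by
      push_cast
      exact Complex.natCast_mul_natCast_cpow k n _
    have e4 : ((((k * n : ℕ) : ℝ) ^ (-a) : ℝ) : ℂ) =
        (((k : ℝ) ^ (-a) : ℝ) : ℂ) * (((n : ℝ) ^ (-a) : ℝ) : ℂ) := by
      rw [Nat.cast_mul, Real.mul_rpow (Nat.cast_nonneg k) (Nat.cast_nonneg n)]
      push_cast
      ring
    rw [e3, e4]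
    ring
  · rw [mul_zero]

/-! ### The off-diagonal bound for `∫ w |ψ A_t|²` -/

/-- **Mean square of `ψ · A_t` against a `C¹` weight: diagonal plus off-diagonal error.** Let
`ψ(s) = Σ_{k ≤ K} β_k k^{−s}` with `|β_k| ≤ B`, `A_t(s) = Σ_{n ≤ ⌊√(t/2π)⌋} α_n n^{−s}` with
`|α_n| ≤ C` (`n ≤ N' = ⌊√(T'/2π)⌋`), `a ≤ ½`, `0 ≤ T ≤ T'`, and a real weight `w` with continuous
derivative on `[T, T']`, `|w| ≤ W₀`, `∫_T^{T'}|w'| ≤ W₁`. With the pairs `i = (k, n)`,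
`x_i = β_k α_n (kn)^{−a}`, `μ_i = kn ≤ M = KN'`, `τ_i = 2πn²`:
`‖∫_T^{T'} w(t) |ψ(a+it) A_t(a+it)|² dt − Σ_{μ_j = μ_i} x_i x̄_j ∫_T^{T'} [τ_i ≤ t][τ_j ≤ t] w(t) dt‖`
`  ≤ (2W₀ + W₁) · 2M(1 + log M) · B²C² M^{1−2a} (1 + log N')(1 + log K)³`
(the tree's `DirichletMVT.norm_weighted_meanSquare_activated_sub_le_crude` for the activated form of
the product, `LevinsonMS.mul_sum_eq_activated`, and the coincidence sum
`LevinsonSums.sum_coincidence_div_le` for `Σ_{kn = k'n'} (kn)^{−2a} ≤ M^{1−2a} Σ_{kn=k'n'} 1/(kn)`).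
This is the analytic content of Levinson's `I₁₁` (`w ≡ 1`, `α_n = 1 − log n/L`) and, through
`|ψ g₂| = |ψ ḡ₂|`, of `I₂₂` (`w = (t/2π)^{1−2a}`), Adv. Math. 13 (1974) §4; the diagonal is left
for the arithmetic evaluation. [cite: Levinson1974, §4] -/
theorem norm_weighted_meanSquare_mul_sub_diag_le (β α : ℕ → ℂ) (K : ℕ) {a T T' B C W₀ W₁ : ℝ}
    (ha : a ≤ 1 / 2) (hT : 0 ≤ T) (hTT' : T ≤ T')
    (hβ : ∀ k ∈ Finset.Icc 1 K, ‖β k‖ ≤ B)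
    (hα : ∀ n ∈ Finset.Icc 1 ⌊Real.sqrt (T' / (2 * π))⌋₊, ‖α n‖ ≤ C)
    {w w' : ℝ → ℝ} (hw : ∀ t ∈ Icc T T', HasDerivAt w (w' t) t)
    (hw' : ContinuousOn w' (Icc T T')) (hW₀ : ∀ t ∈ Icc T T', |w t| ≤ W₀)
    (hW₁ : ∫ t in T..T', |w' t| ≤ W₁) :
    ‖(∫ t in T..T', (((w t *
          ‖(∑ k ∈ Finset.Icc 1 K, β k * (k : ℂ) ^ (-((a : ℂ) + t * I))) *
            (∑ n ∈ Finset.Icc 1 ⌊Real.sqrt (t / (2 * π))⌋₊, α n * (n : ℂ) ^ (-((a : ℂ) + t * I)))‖ ^ 2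
          : ℝ) : ℂ))) -
        ∑ i ∈ Finset.Icc 1 K ×ˢ Finset.Icc 1 ⌊Real.sqrt (T' / (2 * π))⌋₊,
          ∑ j ∈ (Finset.Icc 1 K ×ˢ Finset.Icc 1 ⌊Real.sqrt (T' / (2 * π))⌋₊) with
              j.1 * j.2 = i.1 * i.2,
            (β i.1 * α i.2 * ((((i.1 * i.2 : ℕ) : ℝ) ^ (-a) : ℝ) : ℂ)) *
              conj (β j.1 * α j.2 * ((((j.1 * j.2 : ℕ) : ℝ) ^ (-a) : ℝ) : ℂ)) *
              ∫ t in T..T', (if 2 * π * ((i.2 : ℕ) : ℝ) ^ 2 ≤ t ∧ 2 * π * ((j.2 : ℕ) : ℝ) ^ 2 ≤ t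
                then ((w t : ℝ) : ℂ) else 0)‖ ≤
      (2 * W₀ + W₁) * (2 * ((K * ⌊Real.sqrt (T' / (2 * π))⌋₊ : ℕ) : ℝ) *
          (1 + Real.log ((K * ⌊Real.sqrt (T' / (2 * π))⌋₊ : ℕ) : ℝ))) *
        (B ^ 2 * C ^ 2 * ((K * ⌊Real.sqrt (T' / (2 * π))⌋₊ : ℕ) : ℝ) ^ (1 - 2 * a) *
          ((1 + Real.log (⌊Real.sqrt (T' / (2 * π))⌋₊ : ℕ)) * (1 + Real.log K) ^ 3)) := by
  classical
  have hπ := Real.pi_pos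
  set N' : ℕ := ⌊Real.sqrt (T' / (2 * π))⌋₊ with hN'def
  set S : Finset (ℕ × ℕ) := Finset.Icc 1 K ×ˢ Finset.Icc 1 N' with hSdef
  set x : ℕ × ℕ → ℂ := fun i => β i.1 * α i.2 * ((((i.1 * i.2 : ℕ) : ℝ) ^ (-a) : ℝ) : ℂ) with hxdef
  set μ : ℕ × ℕ → ℕ := fun i => i.1 * i.2 with hμdef
  set τ : ℕ × ℕ → ℝ := fun i => 2 * π * ((i.2 : ℕ) : ℝ) ^ 2 with hτdef
  set M : ℕ := K * N' with hMdef
  have hμ1 : ∀ i ∈ S, 1 ≤ μ i := by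
    intro i hi
    rw [hSdef, Finset.mem_product, Finset.mem_Icc, Finset.mem_Icc] at hi
    exact Nat.one_le_iff_ne_zero.2 (Nat.mul_ne_zero (by omega) (by omega))
  have hμM : ∀ i ∈ S, μ i ≤ M := by
    intro i hi
    rw [hSdef, Finset.mem_product, Finset.mem_Icc, Finset.mem_Icc] at hi
    exact Nat.mul_le_mul hi.1.2 hi.2.2
  -- Step 1: the integrand in activated form on `[T, T']`
  have hN'mono : ∀ t ∈ Icc T T', ⌊Real.sqrt (t / (2 * π))⌋₊ ≤ N' := fun t ht =>
    Nat.floor_le_floor (Real.sqrt_le_sqrt (by gcongr; exact ht.2))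
  have hintegrand : EqOn
      (fun t : ℝ => (((w t *
          ‖(∑ k ∈ Finset.Icc 1 K, β k * (k : ℂ) ^ (-((a : ℂ) + t * I))) *
            (∑ n ∈ Finset.Icc 1 ⌊Real.sqrt (t / (2 * π))⌋₊, α n * (n : ℂ) ^ (-((a : ℂ) + t * I)))‖ ^ 2
          : ℝ) : ℂ)))
      (fun t : ℝ => (((w t * ‖∑ i ∈ S, (if τ i ≤ t then x i * (μ i : ℂ) ^ (-((t : ℂ) * I)) else 0)‖ ^ 2
          : ℝ) : ℂ)))
      (uIcc T T') := by
    intro t ht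
    rw [uIcc_of_le hTT'] at ht
    have ht0 : 0 ≤ t := hT.trans ht.1
    simp only
    rw [mul_sum_eq_activated β α K a ht0 (hN'mono t ht)]
  rw [intervalIntegral.integral_congr hintegrand]
  -- Step 2: the activated mean value theorem
  have hmvt := DirichletMVT.norm_weighted_meanSquare_activated_sub_le_crude S x μ τ hμ1 hμM hTT'
    hw hw' hW₀ hW₁
  refine hmvt.trans ?_
  -- Step 3: the diagonal pairs
  have hW₀0 : 0 ≤ W₀ := (abs_nonneg _).trans (hW₀ T ⟨le_rfl, hTT'⟩)
  have hW₁0 : 0 ≤ W₁ := le_trans (intervalIntegral.integral_nonneg hTT' fun t _ => abs_nonneg _) hW₁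
  have hMnn : (0 : ℝ) ≤ (M : ℝ) := Nat.cast_nonneg M
  have hlogM : 0 ≤ 1 + Real.log (M : ℝ) := by
    rcases Nat.eq_zero_or_pos M with h | h
    · rw [h]; simp
    · have : (1 : ℝ) ≤ M := by exact_mod_cast h
      linarith [Real.log_nonneg this]
  have hpre : 0 ≤ (2 * W₀ + W₁) * (2 * (M : ℝ) * (1 + Real.log (M : ℝ))) := by positivity
  -- norms of the coefficients
  have hxnorm : ∀ i ∈ S, ‖x i‖ ≤ B * C * ((μ i : ℕ) : ℝ) ^ (-a) ∧ 0 ≤ B ∧ 0 ≤ C := by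
    intro i hi
    have hi' := hi
    rw [hSdef, Finset.mem_product] at hi'
    have hb := hβ i.1 hi'.1
    have hc := hα i.2 hi'.2
    have hB0 : 0 ≤ B := (norm_nonneg _).trans hb
    have hC0 : 0 ≤ C := (norm_nonneg _).trans hc
    refine ⟨?_, hB0, hC0⟩
    simp only [hxdef, hμdef, norm_mul, Complex.norm_real, Real.norm_eq_abs]
    rw [abs_of_nonneg (Real.rpow_nonneg (Nat.cast_nonneg _) _)]
    exact mul_le_mul (mul_le_mul hb hc (norm_nonneg _) hB0) le_rfl
      (Real.rpow_nonneg (Nat.cast_nonneg _) _) (mul_nonneg hB0 hC0)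
  have hpair : ∀ i ∈ S, ∀ j ∈ S, μ j = μ i →
      ‖x i‖ * ‖x j‖ ≤ B ^ 2 * C ^ 2 * (M : ℝ) ^ (1 - 2 * a) * (1 / ((μ i : ℕ) : ℝ)) := by
    intro i hi j hj hij
    obtain ⟨hxi, hB0, hC0⟩ := hxnorm i hi
    obtain ⟨hxj, _, _⟩ := hxnorm j hj
    rw [hij] at hxj
    have hm1 : (1 : ℝ) ≤ (μ i : ℕ) := by exact_mod_cast hμ1 i hi
    have hm0 : (0 : ℝ) < (μ i : ℕ) := by linarith
    have hmM : ((μ i : ℕ) : ℝ) ≤ M := by exact_mod_cast hμM i hi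
    have hpow : ((μ i : ℕ) : ℝ) ^ (-a) * ((μ i : ℕ) : ℝ) ^ (-a) ≤ (M : ℝ) ^ (1 - 2 * a) * (1 / ((μ i : ℕ) : ℝ)) := by
      rw [← Real.rpow_add hm0, show -a + -a = (1 - 2 * a) + (-1 : ℝ) by ring, Real.rpow_add hm0,
        Real.rpow_neg_one, one_div]
      exact mul_le_mul_of_nonneg_right (Real.rpow_le_rpow hm0.le hmM (by linarith))
        (inv_nonneg.2 hm0.le)
    calc ‖x i‖ * ‖x j‖ ≤ (B * C * ((μ i : ℕ) : ℝ) ^ (-a)) * (B * C * ((μ i : ℕ) : ℝ) ^ (-a)) :=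
          mul_le_mul hxi hxj (norm_nonneg _) (by positivity)
      _ = B ^ 2 * C ^ 2 * (((μ i : ℕ) : ℝ) ^ (-a) * ((μ i : ℕ) : ℝ) ^ (-a)) := by ring
      _ ≤ B ^ 2 * C ^ 2 * ((M : ℝ) ^ (1 - 2 * a) * (1 / ((μ i : ℕ) : ℝ))) :=
          mul_le_mul_of_nonneg_left hpow (by positivity)
      _ = _ := by ring
  have hsum : ∑ i ∈ S, ∑ j ∈ S with μ j = μ i, ‖x i‖ * ‖x j‖ ≤
      B ^ 2 * C ^ 2 * (M : ℝ) ^ (1 - 2 * a) * ∑ i ∈ S, ∑ j ∈ S with μ j = μ i, (1 / ((μ i : ℕ) : ℝ)) := by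
    rw [Finset.mul_sum]
    refine Finset.sum_le_sum fun i hi => ?_
    rw [Finset.mul_sum]
    refine Finset.sum_le_sum fun j hj => ?_
    rw [Finset.mem_filter] at hj
    exact hpair i hi j hj.1 hj.2
  -- the coincidence sum
  have hcoin : ∑ i ∈ S, ∑ j ∈ S with μ j = μ i, (1 / ((μ i : ℕ) : ℝ)) ≤
      (1 + Real.log (N' : ℕ)) * (1 + Real.log K) ^ 3 := by
    have e : ∑ i ∈ S, ∑ j ∈ S with μ j = μ i, (1 / ((μ i : ℕ) : ℝ)) =
        ∑ k ∈ Finset.Icc 1 K, ∑ k' ∈ Finset.Icc 1 K, ∑ n ∈ Finset.Icc 1 N', ∑ n' ∈ Finset.Icc 1 N',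
          (if k * n = k' * n' then (1 : ℝ) / ((k : ℝ) * n) else 0) := by
      simp only [Finset.sum_filter, hSdef, hμdef, Finset.sum_product]
      refine Finset.sum_congr rfl fun k _ => ?_
      rw [Finset.sum_comm]
      refine Finset.sum_congr rfl fun k' _ => Finset.sum_congr rfl fun n _ =>
        Finset.sum_congr rfl fun n' _ => ?_
      by_cases h : k * n = k' * n'
      · rw [if_pos h.symm, if_pos h]; push_cast; ring
      · rw [if_neg (fun h' => h h'.symm), if_neg h]
    rw [e]
    exact LevinsonSums.sum_coincidence_div_le K N'
  have hBC : 0 ≤ B ^ 2 * C ^ 2 * (M : ℝ) ^ (1 - 2 * a) := by positivity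
  calc (2 * W₀ + W₁) * (2 * (M : ℝ) * (1 + Real.log (M : ℝ))) *
        ∑ i ∈ S, ∑ j ∈ S with μ j = μ i, ‖x i‖ * ‖x j‖
      ≤ (2 * W₀ + W₁) * (2 * (M : ℝ) * (1 + Real.log (M : ℝ))) *
        (B ^ 2 * C ^ 2 * (M : ℝ) ^ (1 - 2 * a) * ((1 + Real.log (N' : ℕ)) * (1 + Real.log K) ^ 3)) := by
        refine mul_le_mul_of_nonneg_left (hsum.trans ?_) hpre
        exact mul_le_mul_of_nonneg_left hcoin hBC
    _ = _ := by simp only [hMdef]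

end LevinsonMS

end Literature.NumberTheory.LFunctions
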